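import Literature.AlgebraicGeometry.HodgeTheory.AbelianVarietyEndomorphismsHOne
import Literature.AlgebraicGeometry.Motives.HyperbolicWeilType
import Literature.AlgebraicGeometry.Motives.HyperbolicWeilTypeOfRationalModel
import Literature.AlgebraicTopology.SingularHomology.CupProductProofs
import Mathlib.LinearAlgebra.Determinant
import Mathlib.LinearAlgebra.Dual.Lemmas
import Mathlib.LinearAlgebra.Projection
import HarnessLib

/-!
# The rational degree-one model of a Weil pair with a compatible polarization class is of Weil type

Layer `Literature/AlgebraicGeometry/Motives`, companion of `Motives/RationalDegreeOneModel`
(rational degree-one models `(u, M, ω, G, d)` of `(A, φ, h)` exist) and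
`Motives/HyperbolicWeilTypeProduct`. The aiming arithmetic of the product trick (Markman,
arXiv:2509.23403 §11.5 Step 2; van Geemen, LNM 1594, 5.2–5.4) is applied to the RATIONAL MODEL of a
Weil pair `(A, φ)`, `φ ≫ φ = -d`, with a `φ`-COMPATIBLE polarization class `h` (`φ^* h = d·h`, as for
the `K`-symmetrised hyperplane class `d·η + φ^*η`); it needs the Gram matrix `G` of the
polarization pairing `Q_h(uᵢ, u_k) = h^{dim A - 1} ⌣ uᵢ ⌣ u_k = G i k · ω` to be ALTERNATING and of
WEIL TYPE for the rational matrix `M` of `φ^*`: `Mᵀ G M = d · G`, i.e.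
`Q_h(φ^*x, φ^*y) = d · Q_h(x, y)` (van Geemen, LNM 1594, 4.9 and Lemma 5.2 (2): `(√-d)^* E = d E`).
This file proves both, the second GRANTED `dim H¹(A(ℂ); ℂ) = 2 dim A` and "`H^{2 dim A}` is
spanned by products of degree-one classes" (two consequences of `H•(A(ℂ); ℂ) = ⋀• H¹`,
Birkenhake–Lange Lemma 1.1.17; theorems of the tree for abelian varieties, see
`Motives/AbelianVarietyCohomologyExteriorH1`), taken as explicit hypotheses `hrank`, `hspan`,
through the classical computation of the degree of `φ` on the top cohomology:

* `AlternatingMap.map_comp_eq_det_smul'` — linear algebra: an alternating map in `dim M` vectors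
  transforms under an endomorphism `f` by `det f`;
* `det_map_one_eq_pow` — **`det(φ^*|_{H¹}) = d^{½ b₁}`** for `φ ≫ φ = -d`: `H¹ = V₊ ⊕ V₋`, the
  `± i√d`-eigenspaces, of EQUAL dimension (`finrank_eigenspace_eq_finrank_eigenspace_neg`,
  Lange–Birkenhake Prop. 1.1.9), so `det = (i√d)ᵃ(-i√d)ᵃ = dᵃ` — unconditional;
* `map_top_eq_det_smul` — under `hrank`, `hspan`, `φ^*` acts on the top cohomology
  `H^{2 dim A}(A(ℂ); ℂ) = ⋀^{2 dim A} H¹` by `det(φ^*|_{H¹})` (`= d^{dim A}`: the degree of `φ`);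
* `gram_map_eq_mul_gram` — **Weil type of the model: `Σ_{a,b} M a i · G a b · M b k = d · G i k`**
  from `φ^* Q_h(uᵢ, u_k) = Q_{φ^*h}(φ^*uᵢ, φ^*u_k) = d^{dim A - 1} Q_h(φ^*uᵢ, φ^*u_k)` (naturality,
  `map_polarizationPairingOne`; compatibility; `polarizationPairingOne_smul`) and
  `φ^* ω = d^{dim A} ω`;
* `gram_antisymm` — `G i k = -G k i` (graded commutativity in degree one), unconditional.

Provenance: first landed on the summit side (route `HeckePrymWeil` of the Hodge summit, file
`Theorems/HeckePrymWeilAimedDescendingWeilTypeModel`, same statements and proofs); re-hosted here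
because the facts that need it are Literature facts, whose discharges cannot import `Summits`
(CONVENTIONS §2). Everything is proved; no definition and no named fact is introduced.

## References

* [vanGeemen1994HodgeAV] B. van Geemen, An introduction to the Hodge conjecture for abelian
  varieties, LNM 1594 (1994), 4.9, Lemma 5.2 (2).
* [LangeBirkenhake1992] H. Lange, Ch. Birkenhake, Complex Abelian Varieties (1992), Prop. 1.1.9,
  Lemma 1.1.17, Exercise 1.1.6 (7)–(8).
* [HatcherAT2002] A. Hatcher, Algebraic Topology (2002), Thm. 3.11.
-/

noncomputable section

open CategoryTheory
open Literature.AlgebraicGeometry Literature.AlgebraicGeometry.HodgeTheory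
open Literature.AlgebraicTopology.SingularHomology
open Literature.Geometry.Kaehler

namespace Literature.AlgebraicGeometry.Motives

/-! ### Linear algebra: alternating maps in `dim M` vectors transform by the determinant -/

/-- For a basis `e` of `M` indexed by `ι`, an `N`-valued alternating map `g` in `ι`-indexed families
and an endomorphism `f` of `M`: `g (f ∘ v) = det f • g v` (scalar case: Mathlib's
`AlternatingMap.eq_smul_basis_det` with `Basis.det_comp`; the vector-valued case by testing against
linear functionals, which separate points). [folklore] -/
theorem AlternatingMap.map_comp_eq_det_smul' {K M N ι : Type*} [Field K] [AddCommGroup M] [Module K M]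
    [AddCommGroup N] [Module K N] [Fintype ι] [DecidableEq ι] (e : Module.Basis ι K M)
    (g : M [⋀^ι]→ₗ[K] N) (f : M →ₗ[K] M) (v : ι → M) :
    g (f ∘ v) = LinearMap.det f • g v := by
  rw [← sub_eq_zero, ← Module.forall_dual_apply_eq_zero_iff K]
  intro ℓ
  have key : ∀ w : ι → M, ℓ (g w) = (ℓ.compAlternatingMap g) e * e.det w := fun w => by
    have h := congrArg (fun F : M [⋀^ι]→ₗ[K] K => F w)
      ((ℓ.compAlternatingMap g).eq_smul_basis_det e)
    simpa only [AlternatingMap.smul_apply, LinearMap.compAlternatingMap_apply, smul_eq_mul] using h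
  rw [map_sub, map_smul, key (f ∘ v), key v, e.det_comp, smul_eq_mul]
  ring

variable {A : Motives.AbelianVariety ℂ}

/-! ### `det(φ^*|_{H¹}) = d^{½ b₁}` for `φ ≫ φ = -d` -/

/-- **The determinant of `φ^*` on `H¹(A(ℂ); ℂ)` is `dᵃ`, `a = dim V₊ = dim V₋ = ½ b₁`**, for an
endomorphism `φ` with `φ ≫ φ = -d`, `d ≥ 1`: `H¹ = V₊ ⊕ V₋` (the `± i√d`-eigenspaces, the tree's
`isCompl_eigenspace_eigenspace_neg`), `φ^*` is the scalar `± i√d` on `V±`, the two have the same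
dimension (`finrank_eigenspace_eq_finrank_eigenspace_neg`, Lange–Birkenhake Prop. 1.1.9), and
`(i√d)ᵃ · (-i√d)ᵃ = dᵃ`. Unconditional. [cite: LangeBirkenhake1992, Prop. 1.1.9] -/
theorem det_map_one_eq_pow {d : ℕ} (hd : 0 < d) {φ : A ⟶ A} (hφ : φ ≫ φ = -(d • 𝟙 A)) :
    LinearMap.det (complexBetti.map φ.hom.hom.hom 1).hom =
      (d : ℂ) ^ Module.finrank ℂ (Module.End.eigenspace (complexBetti.map φ.hom.hom.hom 1).hom
        (Complex.I * (Real.sqrt d : ℂ))) := by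
  haveI : Module.Finite ℂ (complexBetti A.X 1) := finite_complexBetti_abelianVariety A 1
  set s : ℂ := Complex.I * (Real.sqrt d : ℂ) with hs
  set T := (complexBetti.map φ.hom.hom.hom 1).hom with hT
  set p := Module.End.eigenspace T s with hp
  set q := Module.End.eigenspace T (-s) with hq
  have hc : IsCompl p q := isCompl_eigenspace_eigenspace_neg hd hφ
  have hss : s * s = -(d : ℂ) := by
    have h2 : ((Real.sqrt d : ℝ) : ℂ) * ((Real.sqrt d : ℝ) : ℂ) = (d : ℂ) := by
      rw [← Complex.ofReal_mul, Real.mul_self_sqrt (Nat.cast_nonneg d)]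
      push_cast
      rfl
    rw [hs]
    linear_combination Complex.I_mul_I * ((Real.sqrt d : ℝ) : ℂ) * ((Real.sqrt d : ℝ) : ℂ) - h2
  -- `T` is conjugate to `s • id × (-s) • id` on `p × q`
  let e : (p × q) ≃ₗ[ℂ] complexBetti A.X 1 := Submodule.prodEquivOfIsCompl p q hc
  have hconj : (e : (p × q) →ₗ[ℂ] complexBetti A.X 1) ∘ₗ
      (LinearMap.prodMap (s • LinearMap.id) ((-s) • LinearMap.id)) ∘ₗ
        (e.symm : complexBetti A.X 1 →ₗ[ℂ] (p × q)) = T := by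
    refine LinearMap.ext fun x => ?_
    obtain ⟨y, rfl⟩ := e.surjective x
    simp only [LinearMap.comp_apply, LinearEquiv.coe_coe, LinearEquiv.symm_apply_apply,
      LinearMap.prodMap_apply, LinearMap.smul_apply, LinearMap.id_apply]
    rw [Submodule.coe_prodEquivOfIsCompl', Submodule.coe_prodEquivOfIsCompl', map_add,
      Submodule.coe_smul, Submodule.coe_smul]
    have h1 : T (y.1 : complexBetti A.X 1) = s • (y.1 : complexBetti A.X 1) :=
      Module.End.mem_eigenspace_iff.1 y.1.2
    have h2 : T (y.2 : complexBetti A.X 1) = (-s) • (y.2 : complexBetti A.X 1) :=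
      Module.End.mem_eigenspace_iff.1 y.2.2
    rw [h1, h2]
  rw [← hconj, LinearMap.det_conj, LinearMap.det_prodMap, LinearMap.det_smul, LinearMap.det_smul]
  simp only [LinearMap.det_id, mul_one]
  rw [← finrank_eigenspace_eq_finrank_eigenspace_neg hd hφ, ← mul_pow,
    show s * -s = (d : ℂ) by rw [mul_neg, hss, neg_neg]]

/-! ### `φ^*` on the top cohomology is `det(φ^*|_{H¹})` (granted `H• = ⋀• H¹`) -/

/-- **`φ^* = det(φ^*|_{H¹})` on `H^{2 dim A}(A(ℂ); ℂ)`** (degree spelt `2 + 2j`, `dim A = j + 1`),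
GRANTED `dim H¹ = 2 dim A` (`hrank`) and that the top cohomology is spanned by the products
`v₁ ⌣ ⋯ ⌣ v_{2 dim A}` of degree-one classes (`hspan`; both are fields of the named fact
`Motives.abelianVarietyCohomologyExteriorH1`): such a product is an alternating function of `v`,
`φ^*` is multiplicative, and an alternating map in `dim H¹` vectors transforms by the determinant
(`AlternatingMap.map_comp_eq_det_smul'`). [cite: LangeBirkenhake1992, Lemma 1.1.17 and Exercise 1.1.6 (7)–(8)] -/
theorem map_top_eq_det_smul {j : ℕ} (hA : A.dim = j + 1)
    (hrank : Module.finrank ℂ (complexBetti A.X 1) = 2 * A.dim)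
    (hspan : Submodule.span ℂ (Set.range (cupPowOne ℂ (Motives.ComplexPoints A.X) (2 + 2 * j))) = ⊤)
    (φ : A ⟶ A) (x : complexBetti A.X (2 + 2 * j)) :
    complexBetti.map φ.hom.hom.hom (2 + 2 * j) x =
      LinearMap.det (complexBetti.map φ.hom.hom.hom 1).hom • x := by
  classical
  haveI : Module.Finite ℂ (complexBetti A.X 1) := finite_complexBetti_abelianVariety A 1
  have hrank' : Module.finrank ℂ (complexBetti A.X 1) = 2 + 2 * j := by
    rw [hrank, hA]
    ring
  let e : Module.Basis (Fin (2 + 2 * j)) ℂ (complexBetti A.X 1) := Module.finBasisOfFinrankEq ℂ _ hrank'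
  have key : (complexBetti.map φ.hom.hom.hom (2 + 2 * j)).hom =
      LinearMap.det (complexBetti.map φ.hom.hom.hom 1).hom • LinearMap.id := by
    refine LinearMap.ext_on_range hspan fun v => ?_
    change singularCohomology.map ℂ ℂ _ (2 + 2 * j) (cupPowOne ℂ (Motives.ComplexPoints A.X) (2 + 2 * j) v) = _
    rw [LinearMap.smul_apply, LinearMap.id_apply, map_cupPowOne, ← cupPowOneAlt_apply,
      ← cupPowOneAlt_apply]
    exact AlternatingMap.map_comp_eq_det_smul' e (cupPowOneAlt ℂ (Motives.ComplexPoints A.X) (2 + 2 * j))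
      (complexBetti.map φ.hom.hom.hom 1).hom v
  exact LinearMap.congr_fun key x

/-- Hence, for `φ ≫ φ = -d`: **`φ^* = d^{dim A}` on `H^{2 dim A}(A(ℂ); ℂ)`** (the degree of the
isogeny `φ` is `d^{dim A}`), GRANTED `hrank`, `hspan` (fields of `Motives.abelianVarietyCohomologyExteriorH1`).
[cite: LangeBirkenhake1992, Prop. 1.1.9 and Lemma 1.1.17] -/
theorem map_top_eq_pow_smul {j : ℕ} (hA : A.dim = j + 1)
    (hrank : Module.finrank ℂ (complexBetti A.X 1) = 2 * A.dim)
    (hspan : Submodule.span ℂ (Set.range (cupPowOne ℂ (Motives.ComplexPoints A.X) (2 + 2 * j))) = ⊤)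
    {d : ℕ} (hd : 0 < d) {φ : A ⟶ A} (hφ : φ ≫ φ = -(d • 𝟙 A)) (x : complexBetti A.X (2 + 2 * j)) :
    complexBetti.map φ.hom.hom.hom (2 + 2 * j) x = ((d : ℂ) ^ (j + 1)) • x := by
  rw [map_top_eq_det_smul hA hrank hspan φ x, det_map_one_eq_pow hd hφ]
  congr 2
  have h2 := two_mul_finrank_eigenspace_eq hd hφ
  rw [hrank, hA] at h2
  omega

/-! ### Weil type and alternation of the rational model -/

variable {ι : Type*} [Fintype ι]

/-- **The rational model of a Weil pair with a compatible polarization class is of Weil type**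
(van Geemen, LNM 1594, 4.9 / Lemma 5.2 (2): `(√-d)^* E = d E`), GRANTED `hrank`, `hspan`
(fields of `Motives.abelianVarietyCohomologyExteriorH1`). Let `φ ≫ φ = -d` (`d ≥ 1`), `dim A = j + 1`,
`h ∈ H²(A(ℂ); ℂ)` with `φ^* h = d·h`, `u : ι → H¹` with `φ^* uᵢ = Σ_a M a i • u_a`, and
`Q_{h,j}(uᵢ, u_k) = G i k • ω` with `ω ≠ 0`. Then `Σ_{a,b} M a i · G a b · M b k = d · G i k`
(`Mᵀ G M = d G`): both sides are the coefficient of `ω` in `Q_h(φ^*uᵢ, φ^*u_k)`, computed once by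
bilinearity and once as `d^{-j} φ^*(Q_h(uᵢ, u_k)) = d^{-j} · G i k · d^{j+1} · ω` (naturality
`map_polarizationPairingOne`, compatibility, `polarizationPairingOne_smul`, `map_top_eq_pow_smul`).
[cite: vanGeemen1994HodgeAV, 4.9 and Lemma 5.2 (2)] -/
theorem gram_map_eq_mul_gram {j : ℕ} (hA : A.dim = j + 1)
    (hrank : Module.finrank ℂ (complexBetti A.X 1) = 2 * A.dim)
    (hspan : Submodule.span ℂ (Set.range (cupPowOne ℂ (Motives.ComplexPoints A.X) (2 + 2 * j))) = ⊤)
    {d : ℕ} (hd : 0 < d) {φ : A ⟶ A} (hφ : φ ≫ φ = -(d • 𝟙 A))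
    {h : complexBetti A.X 2} (hh : complexBetti.map φ.hom.hom.hom 2 h = (d : ℂ) • h)
    (u : ι → complexBetti A.X 1) (M : Matrix ι ι ℚ)
    (hM : ∀ i, complexBetti.map φ.hom.hom.hom 1 (u i) = ∑ a, ((M a i : ℚ) : ℂ) • u a)
    {ω : complexBetti A.X (2 + 2 * j)} (hω0 : ω ≠ 0) (G : Matrix ι ι ℚ)
    (hG : ∀ i k, Motives.polarizationPairingOne A.X h j (u i) (u k) = ((G i k : ℚ) : ℂ) • ω) (i k : ι) :
    ∑ a, ∑ b, M a i * G a b * M b k = d * G i k := by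
  -- `Q_h(φ^* uᵢ, φ^* u_k)` by bilinearity
  have e1 : Motives.polarizationPairingOne A.X h j (complexBetti.map φ.hom.hom.hom 1 (u i))
      (complexBetti.map φ.hom.hom.hom 1 (u k)) = ((∑ a, ∑ b, M a i * G a b * M b k : ℚ) : ℂ) • ω := by
    rw [hM i, hM k, bilin_sum_smul_sum_smul]
    simp only [hG, smul_smul, Rat.cast_sum, Rat.cast_mul, Finset.sum_smul]
    refine Finset.sum_congr rfl fun a _ => Finset.sum_congr rfl fun b _ => ?_
    ring_nf
  -- `Q_h(φ^* uᵢ, φ^* u_k)` by naturality: `φ^* Q_h(uᵢ, u_k) = Q_{φ^*h}(φ^*uᵢ, φ^*u_k) = d^j Q_h(…)`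
  have e2 := Motives.map_polarizationPairingOne φ.hom.hom.hom h j (u i) (u k)
  rw [hh, Motives.polarizationPairingOne_smul, hG, map_smul, map_top_eq_pow_smul hA hrank hspan hd hφ,
    e1, smul_smul, smul_smul] at e2
  have hd0 : ((d : ℂ) ^ j) ≠ 0 := pow_ne_zero _ (Nat.cast_ne_zero.2 hd.ne')
  have e3 := smul_left_injective ℂ hω0 e2
  have e4 : ((∑ a, ∑ b, M a i * G a b * M b k : ℚ) : ℂ) = ((d * G i k : ℚ) : ℂ) := by
    apply mul_left_cancel₀ hd0
    rw [← e3]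
    push_cast
    ring
  exact_mod_cast e4

omit [Fintype ι] in
/-- **The Gram matrix of the polarization pairing in degree one is alternating**: `G i k = -G k i`
(graded commutativity `x ⌣ y = -(y ⌣ x)` for degree-one classes, Hatcher Thm. 3.11; `ω ≠ 0`).
Unconditional. [cite: HatcherAT2002, Thm. 3.11] -/
theorem gram_antisymm {X : Motives.SchemeOver ℂ} (h : complexBetti X 2) (j : ℕ) (u : ι → complexBetti X 1)
    {ω : complexBetti X (2 + 2 * j)} (hω0 : ω ≠ 0) (G : Matrix ι ι ℚ)
    (hG : ∀ i k, Motives.polarizationPairingOne X h j (u i) (u k) = ((G i k : ℚ) : ℂ) • ω) (i k : ι) :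
    G i k = -G k i := by
  have e := hG i k
  rw [Motives.polarizationPairingOne_apply,
    cupProduct_gradedComm_holds (R := ℂ) (X := Motives.ComplexPoints X) rfl rfl (u i) (u k),
    map_smul, ← Motives.polarizationPairingOne_apply, hG k i, smul_smul, pow_one] at e
  have e' : (-1 * ((G k i : ℚ) : ℂ)) = ((G i k : ℚ) : ℂ) := smul_left_injective ℂ hω0 e
  exact_mod_cast (show ((G i k : ℚ) : ℂ) = ((-G k i : ℚ) : ℂ) by rw [← e']; push_cast; ring)

end Literature.AlgebraicGeometry.Motives

end
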